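import Literature.NumberTheory.GaloisRepresentations.ContinuousH1
import Literature.NumberTheory.GaloisRepresentations.GlobalTriangulineSpace
import Mathlib.Topology.CompactOpen
import HarnessLib

/-!
# Continuous cohomology of a compact group with torsion discrete coefficients is torsion:
# each class of `Hⁿ(G, X)` is killed by a power of `I` when every element of `X` is

Topic `NumberTheory/GaloisRepresentations`; namespace
`Literature.NumberTheory.GaloisRepresentations`; THEOREMS ONLY (no definition, no named fact,
no `sorry`).

Let `G` be a compact (locally compact) topological group, `k` a commutative coefficient ring and
`X : TopRep k G` a topological representation.  Mathlib's continuous cohomology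
`continuousCohomology n X` is the homology of the complex of `G`-invariant homogeneous cochains
`C(G, C(G, ⋯ C(G, X)))` (`TopRep.homogeneousCochains`).  If the coefficients are DISCRETE and every
element of `X` is killed by some power `Iᵐ` of an ideal `I ⊆ k` ("`X = ⋃ X[Iᵐ]`"), then so is
every continuous cochain (a continuous map on a compact space into a discrete one has finite
image) and hence every cohomology class: **`Hⁿ(G, X) = ⋃ₘ Hⁿ(G, X)[Iᵐ]` for all `n`**.  This is
the `k`-module sharpening of the classical "the cohomology groups of a profinite group with
discrete coefficients are torsion" (Serre, *Galois Cohomology* I §2.2, Cor. 3 of Prop. 8), and the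
reading of Greenberg 2006 §3 ("`D = ⋃ D[𝔪ⁿ]` … `Hⁱ(G, C) = lim→ Hⁱ(G, C[𝔪ⁿ])`", p. 358 L20–34) that
the tree's untopologised cofinite-generation criterion
(`IwasawaTheory.Greenberg2006.isCofinitelyGenerated_iff_of_ringEquiv_mvPowerSeries`) consumes:
with it, Greenberg's Prop. 3.2 for `Λ ≅ ℤ_p⟦T₁,…,T_m⟧` reduces to the printed finiteness of
`Hⁱ(G, D)[𝔪]`.

The induction runs over the iterated function spaces with the invariant "every COMPACT subset is
killed by some `J m`" (for an arbitrary family of ideals `J : ℕ → Ideal k`): it passes from `V` to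
`C(G, V)` with the compact-open topology because evaluation `C(G, V) × G → V` is continuous for
locally compact `G` (`ContinuousEval`), and it holds for a discrete `J`-torsion module with `J`
antitone (compact = finite).

* `ContinuousMap.forall_isCompact_exists_smul_eq_zero` — the induction step `V ↝ C(G, V)`;
* `forall_isCompact_exists_smul_eq_zero_of_discreteTopology` — the base case;
* `TopRep.resolutionX_forall_isCompact_exists_smul_eq_zero` — all terms of Mathlib's resolution;
* **`continuousCohomology_exists_forall_smul_eq_zero`**, **`continuousCohomology_exists_pow_smul_eq_zero`**
  — every class of `Hⁿ(G, X)` is killed by some `J m` / some `Iᵐ`;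
* `ContinuousRep.H_exists_pow_smul_eq_zero` — the same for the tree's `ContinuousRep.H`.

## What this file is NOT
No statement about finiteness or cofinite generation of cohomology (Greenberg 2006 Prop. 3.2
itself), no direct-limit comparison `Hⁱ(G, ⋃ Cₙ) = ⋃ Hⁱ(G, Cₙ)` as an isomorphism.

## References
* J.-P. Serre, *Galois Cohomology* (1997), I §2.2 (Prop. 8 and Cor. 3: cohomology of profinite
  groups with discrete coefficients is torsion). [SerreGaloisCohomology1997]
* R. Greenberg, *On the structure of certain Galois cohomology groups*, Doc. Math. Extra Vol.
  Coates (2006) 335–391, §3 A (p. 358 L20–34). [Greenberg2006]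
-/

noncomputable section

open CategoryTheory TopRep ContinuousCohomology

universe u v

namespace Literature.NumberTheory.GaloisRepresentations

/-! ### §1. Compact subsets killed by an ideal of the family: discrete base, function-space step -/

section Step

variable {k : Type u} [CommRing k]

/-- **Base case.** In a DISCRETE `k`-module every element of which is killed by some `J n`
(`J` antitone), every compact — i.e. finite — subset is killed by a single `J n`.
[cite: SerreGaloisCohomology1997, I §2.2 (Prop. 8, Cor. 3)] -/
theorem forall_isCompact_exists_smul_eq_zero_of_discreteTopology {V : Type v} [TopologicalSpace V]
    [DiscreteTopology V] [AddCommGroup V] [Module k V] (J : ℕ → Ideal k) (hJ : Antitone J)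
    (hV : ∀ x : V, ∃ n : ℕ, ∀ r ∈ J n, r • x = 0) :
    ∀ C : Set V, IsCompact C → ∃ n : ℕ, ∀ r ∈ J n, ∀ x ∈ C, r • x = 0 := by
  intro C hC
  choose nf hnf using hV
  obtain ⟨N, hN⟩ := (hC.finite_of_discrete.image nf).bddAbove
  exact ⟨N, fun r hr x hx => hnf x r (hJ (hN ⟨x, hx, rfl⟩) hr)⟩

variable {G : Type v} [TopologicalSpace G] [CompactSpace G] [LocallyCompactSpace G]

/-- **Induction step `V ↝ C(G, V)`** (compact-open topology, pointwise `k`-action) for `G` compact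
and locally compact: if every compact subset of `V` is killed by some `J n`, so is every compact
subset `𝒦 ⊆ C(G, V)` — the evaluation image of `𝒦 × G` is compact.
[cite: SerreGaloisCohomology1997, I §2.2 (Prop. 8, Cor. 3)] -/
theorem ContinuousMap.forall_isCompact_exists_smul_eq_zero {V : Type v} [TopologicalSpace V]
    [AddCommGroup V] [Module k V] [IsTopologicalAddGroup V] [ContinuousConstSMul k V]
    (J : ℕ → Ideal k) (hV : ∀ C : Set V, IsCompact C → ∃ n : ℕ, ∀ r ∈ J n, ∀ x ∈ C, r • x = 0) :
    ∀ C : Set C(G, V), IsCompact C → ∃ n : ℕ, ∀ r ∈ J n, ∀ f ∈ C, r • f = 0 := by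
  intro C hC
  have hE : IsCompact ((fun p : C(G, V) × G => p.1 p.2) '' (C ×ˢ Set.univ)) :=
    (hC.prod isCompact_univ).image continuous_eval
  obtain ⟨n, hn⟩ := hV _ hE
  refine ⟨n, fun r hr f hf => ?_⟩
  ext x
  rw [ContinuousMap.smul_apply, ContinuousMap.zero_apply]
  exact hn r hr (f x) ⟨(f, x), ⟨hf, Set.mem_univ _⟩, rfl⟩

end Step

/-! ### §2. The terms of the resolution and the cohomology classes -/

section Cohomology

variable {k : Type u} [CommRing k] [TopologicalSpace k]
variable {G : Type v} [Group G] [TopologicalSpace G] [IsTopologicalGroup G] [CompactSpace G]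
  [LocallyCompactSpace G]

/-- Every term `C(G, ⋯ C(G, X))` of Mathlib's resolution `TopRep.resolutionX X n` inherits "compact
subsets are killed by some `J m`" from `X`. [cite: SerreGaloisCohomology1997, I §2.2 (Prop. 8, Cor. 3)] -/
theorem TopRep.resolutionX_forall_isCompact_exists_smul_eq_zero (X : TopRep.{v} k G)
    (J : ℕ → Ideal k) (hX : ∀ C : Set X, IsCompact C → ∃ n : ℕ, ∀ r ∈ J n, ∀ x ∈ C, r • x = 0)
    (n : ℕ) :
    ∀ C : Set (resolutionX X n), IsCompact C → ∃ m : ℕ, ∀ r ∈ J m, ∀ x ∈ C, r • x = 0 := by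
  induction n with
  | zero => exact hX
  | succ n ih => exact ContinuousMap.forall_isCompact_exists_smul_eq_zero (G := G) J ih

/-- **Every class of `Hⁿ(G, X)` is killed by some `J m`**, for `G` compact (and locally compact)
and `X : TopRep k G` all of whose compact subsets are killed by some `J m`: a class is represented
by an invariant homogeneous cochain (`cxClass_surjective`), which is one point of a term of the
resolution. [cite: SerreGaloisCohomology1997, I §2.2 (Prop. 8, Cor. 3)] -/
theorem continuousCohomology_exists_forall_smul_eq_zero (X : TopRep.{v} k G) (J : ℕ → Ideal k)
    (hX : ∀ C : Set X, IsCompact C → ∃ n : ℕ, ∀ r ∈ J n, ∀ x ∈ C, r • x = 0) (n : ℕ)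
    (γ : continuousCohomology n X) : ∃ m : ℕ, ∀ r ∈ J m, r • γ = 0 := by
  obtain ⟨c, hc, rfl⟩ :=
    cxClass_surjective (homogeneousCochains X) n (n + 1) (CochainComplex.next ℕ n) γ
  obtain ⟨m, hm⟩ := TopRep.resolutionX_forall_isCompact_exists_smul_eq_zero X J hX (n + 1)
    {(c.1 : (resolutionX X (n + 1) : Type v))} isCompact_singleton
  refine ⟨m, fun r hr => ?_⟩
  have hrc : r • c = 0 :=
    Subtype.ext (hm r hr (c.1 : (resolutionX X (n + 1) : Type v)) (Set.mem_singleton _))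
  have h0 : cxClass (homogeneousCochains X) n (n + 1) (CochainComplex.next ℕ n) 0 (map_zero _) = 0 :=
    (cxClass_eq_zero_iff (homogeneousCochains X) n (n + 1) (CochainComplex.next ℕ n) _ rfl 0
      (map_zero _)).2 ⟨0, map_zero _⟩
  calc r • cxClass (homogeneousCochains X) n (n + 1) (CochainComplex.next ℕ n) c hc
      = cxClass (homogeneousCochains X) n (n + 1) (CochainComplex.next ℕ n) (r • c)
          (by rw [map_smul, hc, smul_zero]) :=
        (cxClass_smul (homogeneousCochains X) n (n + 1) (CochainComplex.next ℕ n) r c hc).symm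
    _ = cxClass (homogeneousCochains X) n (n + 1) (CochainComplex.next ℕ n) 0 (map_zero _) :=
        cxClass_congr hrc
    _ = 0 := h0

/-- **Discrete `I`-power-torsion coefficients have `I`-power-torsion cohomology**: for `G`
compact and `X : TopRep k G` discrete with `X = ⋃ₘ X[Iᵐ]` elementwise, every class of `Hⁿ(G, X)`
is killed by some `Iᵐ` ("`D = ⋃ D[𝔪ⁿ]` … it follows that `Hⁱ(G, C) = lim→ Hⁱ(G, C[𝔪ⁿ])`").
[cite: Greenberg2006, §3 A (p. 358 L20–34)] -/
theorem continuousCohomology_exists_pow_smul_eq_zero (X : TopRep.{v} k G) [DiscreteTopology X]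
    (I : Ideal k) (hX : ∀ x : X, ∃ n : ℕ, ∀ r ∈ I ^ n, r • x = 0) (n : ℕ)
    (γ : continuousCohomology n X) : ∃ m : ℕ, ∀ r ∈ I ^ m, r • γ = 0 :=
  continuousCohomology_exists_forall_smul_eq_zero X (fun m => I ^ m)
    (forall_isCompact_exists_smul_eq_zero_of_discreteTopology (fun m => I ^ m)
      (fun _ _ hab => Ideal.pow_le_pow_right hab) hX) n γ

/-- The classical special case `I = (a)`: if every element of the discrete `X` is killed by a
power of `a ∈ k` (e.g. `a = p`: `X` is `p`-primary), so is every class of `Hⁿ(G, X)`.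
[cite: SerreGaloisCohomology1997, I §2.2 (Prop. 8, Cor. 3)] -/
theorem continuousCohomology_exists_pow_smul_eq_zero_of_span_singleton (X : TopRep.{v} k G)
    [DiscreteTopology X] (a : k) (hX : ∀ x : X, ∃ n : ℕ, a ^ n • x = 0) (n : ℕ)
    (γ : continuousCohomology n X) : ∃ m : ℕ, a ^ m • γ = 0 := by
  have hX' : ∀ x : X, ∃ n : ℕ, ∀ r ∈ Ideal.span {a} ^ n, r • x = 0 := fun x => by
    obtain ⟨n, hn⟩ := hX x
    refine ⟨n, fun r hr => ?_⟩
    rw [Ideal.span_singleton_pow, Ideal.mem_span_singleton] at hr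
    obtain ⟨c, rfl⟩ := hr
    rw [mul_comm, mul_smul, hn, smul_zero]
  obtain ⟨m, hm⟩ := continuousCohomology_exists_pow_smul_eq_zero X (Ideal.span {a}) hX' n γ
  exact ⟨m, hm _ (Ideal.pow_mem_pow (Ideal.mem_span_singleton_self a) m)⟩

end Cohomology

/-! ### §3. The tree's `ContinuousRep.H` -/

section ContinuousRepH

variable {G : Type u} [Group G] [TopologicalSpace G] [IsTopologicalGroup G] [CompactSpace G]
  [LocallyCompactSpace G]
  {A : Type u} [CommRing A] [TopologicalSpace A]
  {M : Type u} [AddCommGroup M] [Module A M] [TopologicalSpace M] [IsTopologicalAddGroup M]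
  [ContinuousSMul A M]

/-- **`H^q_cont(G, M)` is `I`-power torsion** for a compact group `G` acting continuously and
`A`-linearly on a discrete `A`-module `M = ⋃ M[Iⁿ]`: every class is killed by some `Iᵐ` (the
tree's `ContinuousRep.H`, carrier of Mathlib's `continuousCohomology`).
[cite: Greenberg2006, §3 A (p. 358 L20–34)] -/
theorem ContinuousRep.H_exists_pow_smul_eq_zero (ρ : ContinuousRep G A M) [DiscreteTopology M]
    (I : Ideal A) (hM : ∀ x : M, ∃ n : ℕ, ∀ r ∈ I ^ n, r • x = 0) (q : ℕ) (γ : ρ.H q) :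
    ∃ m : ℕ, ∀ r ∈ I ^ m, r • γ = 0 :=
  continuousCohomology_exists_pow_smul_eq_zero ρ.toTopRep I hM q γ

/-- The `p`-primary reading: if every element of the discrete `M` is killed by a power of `a ∈ A`,
so is every class of `H^q_cont(G, M)`. [cite: SerreGaloisCohomology1997, I §2.2 (Prop. 8, Cor. 3)] -/
theorem ContinuousRep.H_exists_pow_smul_eq_zero_of_singleton (ρ : ContinuousRep G A M)
    [DiscreteTopology M] (a : A) (hM : ∀ x : M, ∃ n : ℕ, a ^ n • x = 0) (q : ℕ) (γ : ρ.H q) :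
    ∃ m : ℕ, a ^ m • γ = 0 :=
  continuousCohomology_exists_pow_smul_eq_zero_of_span_singleton ρ.toTopRep a hM q γ

end ContinuousRepH

end Literature.NumberTheory.GaloisRepresentations

end
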